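import Summits.HodgeConjecture.CorCM.Census.BlockParityExactRank

/-!
# The block-parity law, V: the weight-parity cocycle and the transfer — `δ(G, c) = 1 ⟺ g^{|G|/2} = 1` for every `g ∈ G`

COR-CM (cell `pub-hodgecm2`), count-neutral kernel combinatorics by the binder seat b09 (gen 28; lane BLOCK-PARITY-FLOOR),
part V (abstract), sequel of `Census/BlockParityLaw.lean` (I), `Census/BlockParityRelations.lean` (II),
`Census/BlockParityExactRank.lean` (III); consumed by the intrinsic form `CorCM/FaceParityFloor.lean` (IV).  Theorems + one bookkeeping definition (the left transversal `transv`); Mathlib's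
transfer homomorphism (`MonoidHom.transfer_eq_pow`); no certificate, no named fact, no `sorry`.  HONEST FRAMING: `HC_CM` is
NOT proved; nothing here is a period or a headline.

CONTENT (`G` finite, `c ∈ G`, `c² = 1`; from §2 on `c ≠ 1` and, for the transfer, `c` central; `n = |G|/2`; `T₀` a base type).
* §1 **The weight parity is a metric mod 2 and a cocycle**: `wpar A Ψ = wpar A B + wpar B Ψ` (`wpar_triangle`), base change is an
  isometry (`wpar_rt_rt`), hence `wpar T₀ (Ψ·Q⁻¹) = wpar T₀ (T₀·Q⁻¹) + wpar T₀ Ψ` (`wpar_rt`), `Q ↦ wpar T₀ (T₀·Q⁻¹)` is a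
  homomorphism `G → 𝔽₂` (`wpar_rt_mul`), and the weight parity is constant on blocks iff `wpar T₀ (T₀·Q⁻¹) = 0` for all `Q`
  (`invariant_iff_self`) — a check on ONE type.
* §2 **The transfer** `G → ⟨c⟩` computed on the left transversal `T₀⁻¹` (`transv`): for central `c`,
  `g^n = c^{|T₀ ∖ T₀·g|}` (`pow_half_card_eq`), via `MonoidHom.transfer_eq_pow` (the transfer to a central subgroup of index `n`
  is `g ↦ g^n`) and the count of the cosets where the representatives of `T₀⁻¹` and `g·T₀⁻¹` differ.
* §3 **`δ = 1 ⟺ ∀ g, g^n = 1`** (`invariant_iff_forall_pow_eq_one`, `wdelta_eq_one_iff`): the weight parity is constant on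
  blocks iff the exponent of `G` divides `|G|/2`.  So `δ = 0` as soon as ONE element has order not dividing `n`
  (`wdelta_eq_zero_of_pow_ne_one`): every CYCLIC `G` (a generator has order `2n`; the law reads `|S| ≥ β − 1` for all `ℤ/2m`,
  André-3's `μ(ℤ/2m) = β_m − 1` on `2m = 6 … 22`), every `ℤ/2 × A` with `|A|` odd, `Dic_m` (`b² = c`, `b⁴ = 1`, `4 ∤ 2m` for `m` odd);
  and `δ = 1` for `(ℤ/2)^k`, `ℤ/4 × ℤ/4`, `Q₈`, `D₄`, `D_{2m}` (`m` even), `ℤ/2 × ℤ/2m'`, … (exponent divides `n`).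

## References
* [Pohlmann1968] H. Pohlmann, Algebraic cycles on abelian varieties of complex multiplication type, Ann. of Math. 88 (1968), Thm 1.
* [Milne1999] J. S. Milne, Lefschetz motives and the Tate conjecture, Compositio Math. 117 (1999), Prop. 2.1, p. 54.
-/

namespace Summit.HodgeConjecture.CorCM.Census.BlockParity

open Finset
open Summit.HodgeConjecture.CorCM.Prior.AllgGroup.RfwfAllgGroup

noncomputable section

variable {G : Type*} [Group G] [Fintype G] [DecidableEq G] (c : G)

/-! ## §1 The weight parity: triangle identity, isometry of base change, cocycle -/

/-- `wpar T T = 0`. [folklore] -/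
@[simp] theorem wpar_self (T : CMF G c) : wpar c T T = 0 := by
  simp [wpar]

/-- **Triangle identity mod 2**: `wpar A Ψ = wpar A B + wpar B Ψ` (at each place, `[A ≠ Ψ] ≡ [A ≠ B] + [B ≠ Ψ]`). [folklore] -/
theorem wpar_triangle (hc2 : c * c = 1) (A B Ψ : CMF G c) : wpar c A Ψ = wpar c A B + wpar c B Ψ := by
  suffices h : ∀ (n : ℕ) (Ψ : CMF G c), (B.1 \ Ψ.1).card = n → wpar c A Ψ = wpar c A B + wpar c B Ψ from h _ Ψ rfl
  intro n
  induction n with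
  | zero =>
    intro Ψ h0
    rw [eq_of_dev_empty c (Finset.card_eq_zero.mp h0), wpar_self, add_zero]
  | succ m ih =>
    intro Ψ hm
    obtain ⟨s, hs⟩ : (B.1 \ Ψ.1).Nonempty := Finset.card_pos.mp (by omega)
    obtain ⟨hsB, hsΨ⟩ := Finset.mem_sdiff.mp hs
    have h1 : (B.1 \ (oflipCM c hc2 s Ψ).1).card = m := by
      rw [dev_oflip c hc2 hsB hsΨ, Finset.card_erase_of_mem hs]; omega
    have ih' := ih (oflipCM c hc2 s Ψ) h1
    have e : Ψ = oflipCM c hc2 s (oflipCM c hc2 s Ψ) := (oflipCM_oflipCM_self c hc2 s Ψ).symm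
    rw [e, wpar_oflipCM c hc2 A, wpar_oflipCM c hc2 B, ih']
    ring

/-- Base change acts on deviation sets by right translation. [folklore] -/
theorem sdiff_rt (Q : G) (A B : CMF G c) : (rt c Q A).1 \ (rt c Q B).1 = (A.1 \ B.1).image (· * Q⁻¹) := by
  ext P
  simp only [Finset.mem_sdiff, mem_rt, Finset.mem_image]
  constructor
  · rintro ⟨hA, hB⟩
    exact ⟨P * Q, ⟨hA, hB⟩, by rw [mul_inv_cancel_right]⟩
  · rintro ⟨x, ⟨hA, hB⟩, rfl⟩
    rw [inv_mul_cancel_right]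
    exact ⟨hA, hB⟩

/-- **Base change is an isometry** for the weight parity. [folklore] -/
theorem wpar_rt_rt (Q : G) (A B : CMF G c) : wpar c (rt c Q A) (rt c Q B) = wpar c A B := by
  unfold wpar
  rw [sdiff_rt, Finset.card_image_of_injective _ (mul_left_injective Q⁻¹)]

/-- **Cocycle**: `wpar T₀ (Ψ·Q⁻¹) = wpar T₀ (T₀·Q⁻¹) + wpar T₀ Ψ`. [folklore] -/
theorem wpar_rt (hc2 : c * c = 1) (T₀ : CMF G c) (Q : G) (Ψ : CMF G c) :
    wpar c T₀ (rt c Q Ψ) = wpar c T₀ (rt c Q T₀) + wpar c T₀ Ψ := by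
  rw [wpar_triangle c hc2 T₀ (rt c Q T₀) (rt c Q Ψ), wpar_rt_rt]

/-- **`Q ↦ wpar T₀ (T₀·Q⁻¹)` is a homomorphism `G → 𝔽₂`.** [folklore] -/
theorem wpar_rt_mul (hc2 : c * c = 1) (T₀ : CMF G c) (Q Q' : G) :
    wpar c T₀ (rt c (Q * Q') T₀) = wpar c T₀ (rt c Q T₀) + wpar c T₀ (rt c Q' T₀) := by
  rw [rt_mul, wpar_rt c hc2 T₀ Q]

/-- **The weight parity is constant on blocks iff `wpar T₀ (T₀·Q⁻¹) = 0` for every `Q`** — a check on the base type alone.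
[folklore] -/
theorem invariant_iff_self (hc2 : c * c = 1) (T₀ : CMF G c) :
    (∀ (Q : G) (Ψ : CMF G c), wpar c T₀ (rt c Q Ψ) = wpar c T₀ Ψ) ↔ ∀ Q : G, wpar c T₀ (rt c Q T₀) = 0 := by
  constructor
  · intro h Q
    rw [h Q T₀, wpar_self]
  · intro h Q Ψ
    rw [wpar_rt c hc2, h Q, zero_add]

/-! ## §2 The transfer to `⟨c⟩` on the transversal `T₀⁻¹` -/

section Transfer

omit [Fintype G] [DecidableEq G] in
/-- `c` has order `2`. [folklore] -/
theorem orderOf_eq_two (hc2 : c * c = 1) (hc1 : c ≠ 1) : orderOf c = 2 :=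
  orderOf_eq_prime (by rw [pow_two]; exact hc2) hc1

/-- `⟨c⟩ = {1, c}`. [folklore] -/
theorem mem_zpowers_iff_eq (hc2 : c * c = 1) (hc1 : c ≠ 1) (x : G) : x ∈ Subgroup.zpowers c ↔ x = 1 ∨ x = c := by
  rw [mem_zpowers_iff_mem_range_orderOf, orderOf_eq_two c hc2 hc1, Finset.mem_image]
  constructor
  · rintro ⟨a, ha, rfl⟩
    have : a = 0 ∨ a = 1 := by have := Finset.mem_range.mp ha; omega
    rcases this with rfl | rfl
    · exact Or.inl (pow_zero c)
    · exact Or.inr (pow_one c)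
  · rintro (h | h)
    · exact ⟨0, Finset.mem_range.mpr (by omega), by rw [h, pow_zero]⟩
    · exact ⟨1, Finset.mem_range.mpr (by omega), by rw [h, pow_one]⟩

omit [Fintype G] [DecidableEq G] in
/-- `c⁻¹ = c`. [folklore] -/
theorem inv_eq_self' (hc2 : c * c = 1) : c⁻¹ = c := inv_eq_of_mul_eq_one_right hc2

omit [DecidableEq G] in
/-- The index of `⟨c⟩` is `|G|/2`. [folklore] -/
theorem index_zpowers (hc2 : c * c = 1) (hc1 : c ≠ 1) : (Subgroup.zpowers c).index = Fintype.card G / 2 := by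
  have h := (Subgroup.zpowers c).index_mul_card
  rw [Nat.card_zpowers, orderOf_eq_two c hc2 hc1, Nat.card_eq_fintype_card] at h
  omega

/-- **The left transversal `T₀⁻¹ = {x | x⁻¹ ∈ T₀}` of `⟨c⟩`** (a CM type meets every coset `{x, xc}` once). [folklore] -/
def transv (hc2 : c * c = 1) (hc1 : c ≠ 1) (T₀ : CMF G c) : (Subgroup.zpowers c).LeftTransversal :=
  ⟨{x : G | x⁻¹ ∈ T₀.1}, by
    rw [Subgroup.isComplement_iff_existsUnique_inv_mul_mem]
    intro g
    by_cases hg : g⁻¹ ∈ T₀.1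
    · refine ⟨⟨g, hg⟩, by simp, ?_⟩
      rintro ⟨s, hs⟩ hmem
      apply Subtype.ext
      change s⁻¹ ∈ T₀.1 at hs
      change s⁻¹ * g ∈ Subgroup.zpowers c at hmem
      rcases (mem_zpowers_iff_eq c hc2 hc1 _).mp hmem with h | h
      · exact inv_mul_eq_one.mp h
      · exfalso
        have e : g⁻¹ = c * s⁻¹ := by
          rw [inv_mul_eq_iff_eq_mul.mp h, mul_inv_rev, inv_eq_self' c hc2]
        rw [e] at hg
        exact (T₀.2 s⁻¹).mp hs hg
    · have hgc : (g * c)⁻¹ ∈ T₀.1 := by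
        rw [mul_inv_rev, inv_eq_self' c hc2]
        by_contra hh
        exact hg (by have := (T₀.2 (c * g⁻¹)).mpr; rw [cmul_cmul c hc2] at this; exact absurd (this hg) hh)
      refine ⟨⟨g * c, hgc⟩, ?_, ?_⟩
      · change (g * c)⁻¹ * g ∈ Subgroup.zpowers c
        rw [mul_inv_rev, mul_assoc, inv_mul_cancel, mul_one]
        exact Subgroup.inv_mem _ (Subgroup.mem_zpowers c)
      · rintro ⟨s, hs⟩ hmem
        apply Subtype.ext
        change s⁻¹ ∈ T₀.1 at hs
        change s⁻¹ * g ∈ Subgroup.zpowers c at hmem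
        change s = g * c
        rcases (mem_zpowers_iff_eq c hc2 hc1 _).mp hmem with h | h
        · exfalso
          rw [inv_mul_eq_one.mp h] at hs
          exact hg hs
        · rw [inv_mul_eq_iff_eq_mul.mp h, mul_assoc, hc2, mul_one]⟩

/-- Membership in the transversal `T₀⁻¹`. [folklore] -/
theorem mem_transv {hc2 : c * c = 1} {hc1 : c ≠ 1} (T₀ : CMF G c) (x : G) :
    x ∈ (transv c hc2 hc1 T₀ : Set G) ↔ x⁻¹ ∈ T₀.1 := Iff.rfl

/-- The representative of a coset in `T₀⁻¹` is the unique member of the coset whose inverse lies in `T₀`. [folklore] -/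
theorem leftQuotientEquiv_eq (hc2 : c * c = 1) (hc1 : c ≠ 1) (T₀ : CMF G c) (q : G ⧸ Subgroup.zpowers c) (s : G)
    (hs : s⁻¹ ∈ T₀.1)
    (hq : (QuotientGroup.mk s : G ⧸ Subgroup.zpowers c) = q) :
    ((transv c hc2 hc1 T₀).2.leftQuotientEquiv q : G) = s := by
  have bij := Subgroup.isComplement_subgroup_right_iff_bijective.mp (transv c hc2 hc1 T₀).2
  have h1 : (QuotientGroup.mk ((transv c hc2 hc1 T₀).2.leftQuotientEquiv q : G) : G ⧸ Subgroup.zpowers c) = q :=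
    (transv c hc2 hc1 T₀).2.quotientGroupMk_leftQuotientEquiv q
  have h2 : (transv c hc2 hc1 T₀).2.leftQuotientEquiv q = ⟨s, hs⟩ := bij.1 (by
    change (QuotientGroup.mk ((transv c hc2 hc1 T₀).2.leftQuotientEquiv q : G) : G ⧸ Subgroup.zpowers c) =
      QuotientGroup.mk s
    rw [h1, hq])
  rw [h2]

open scoped IsMulCommutative in
/-- In the group `⟨c⟩ = {1, c}` a finite product is `c` to the number of factors equal to `c`. [folklore] -/
theorem coe_prod_eq_pow_card (hc2 : c * c = 1) (hc1 : c ≠ 1) {ι : Type*} (s : Finset ι)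
    (f : ι → Subgroup.zpowers c) :
    ((∏ i ∈ s, f i : Subgroup.zpowers c) : G) = c ^ (s.filter fun i => (f i : G) = c).card := by
  classical
  induction s using Finset.induction_on with
  | empty => simp
  | insert a s ha ih =>
    rw [Finset.prod_insert ha, Subgroup.coe_mul, ih, Finset.filter_insert]
    by_cases hfa : (f a : G) = c
    · rw [if_pos hfa, Finset.card_insert_of_notMem (fun h => ha (Finset.mem_filter.mp h).1), hfa, pow_succ']
    · rw [if_neg hfa]
      rcases (mem_zpowers_iff_eq c hc2 hc1 _).mp (f a).2 with h | h
      · rw [h, one_mul]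
      · exact absurd h hfa

/-- **The transfer identity**: for central `c`, `g^{|G|/2} = c^{|T₀ ∖ T₀·g|}` (`T₀·g = rt g⁻¹ T₀`). [folklore] -/
theorem pow_half_card_eq (hc2 : c * c = 1) (hc1 : c ≠ 1) (hcen : ∀ x : G, x * c = c * x) (T₀ : CMF G c) (g : G) :
    g ^ (Fintype.card G / 2) = c ^ (T₀.1 \ (rt c g⁻¹ T₀).1).card := by
  classical
  letI hfin : Fintype (G ⧸ Subgroup.zpowers c) := (Subgroup.zpowers c).fintypeQuotientOfFiniteIndex
  -- the key hypothesis of `transfer_eq_pow`: `⟨c⟩` is central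
  have key : ∀ (k : ℕ) (g₀ : G), g₀⁻¹ * g ^ k * g₀ ∈ Subgroup.zpowers c → g₀⁻¹ * g ^ k * g₀ = g ^ k := by
    intro k g₀ hk
    have hx : ∀ y : G, y * (g₀⁻¹ * g ^ k * g₀) = (g₀⁻¹ * g ^ k * g₀) * y := by
      intro y
      rcases (mem_zpowers_iff_eq c hc2 hc1 _).mp hk with h | h
      · rw [h, mul_one, one_mul]
      · rw [h, hcen]
    have e1 : g ^ k = g₀ * (g₀⁻¹ * g ^ k * g₀) * g₀⁻¹ := by group
    conv_rhs => rw [e1, mul_assoc, ← hx g₀⁻¹, ← mul_assoc, mul_inv_cancel, one_mul]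
  open scoped IsMulCommutative in
  have ht := MonoidHom.transfer_eq_pow (MonoidHom.id (Subgroup.zpowers c)) g key
  open scoped IsMulCommutative in
  rw [MonoidHom.transfer_def (MonoidHom.id (Subgroup.zpowers c)) (transv c hc2 hc1 T₀) g] at ht
  have hval := congrArg Subtype.val ht
  simp only [MonoidHom.id_apply] at hval
  rw [index_zpowers c hc2 hc1] at hval
  rw [← hval]
  -- evaluate the `diff` of the transversals `T₀⁻¹` and `g·T₀⁻¹`
  open scoped IsMulCommutative in
  simp only [Subgroup.leftTransversals.diff]
  open scoped IsMulCommutative in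
  rw [coe_prod_eq_pow_card c hc2 hc1]
  congr 1
  simp only [MonoidHom.id_apply]
  -- count the cosets where the two representatives differ
  set α := (transv c hc2 hc1 T₀).2.leftQuotientEquiv with hα
  have hmemT : ∀ r : G ⧸ Subgroup.zpowers c, ((α r : G))⁻¹ ∈ T₀.1 := fun r => (α r).2
  refine Finset.card_bij (fun q _ => ((α (g⁻¹ • q) : G))⁻¹) ?_ ?_ ?_
  · intro q hq
    rw [Finset.mem_filter] at hq
    have hp := hq.2
    rw [Subgroup.smul_apply_eq_smul_apply_inv_smul, smul_eq_mul, inv_mul_eq_iff_eq_mul] at hp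
    -- hp : g * α(g⁻¹•q) = α q * c
    rw [Finset.mem_sdiff, mem_rt]
    refine ⟨hmemT _, ?_⟩
    rw [← mul_inv_rev, hp, mul_inv_rev, inv_eq_self' c hc2]
    exact (T₀.2 _).mp (hmemT q)
  · intro q₁ _ q₂ _ h
    have h1 : α (g⁻¹ • q₁) = α (g⁻¹ • q₂) := Subtype.ext (inv_injective h)
    exact smul_left_cancel g⁻¹ (α.injective h1)
  · intro t ht
    rw [Finset.mem_sdiff, mem_rt] at ht
    obtain ⟨htT, htg⟩ := ht
    have hs : (t⁻¹)⁻¹ ∈ T₀.1 := by rw [inv_inv]; exact htT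
    refine ⟨g • (QuotientGroup.mk t⁻¹ : G ⧸ Subgroup.zpowers c), ?_, ?_⟩
    · rw [Finset.mem_filter]
      refine ⟨Finset.mem_univ _, ?_⟩
      rw [Subgroup.smul_apply_eq_smul_apply_inv_smul, inv_smul_smul, smul_eq_mul,
        leftQuotientEquiv_eq c hc2 hc1 T₀ _ t⁻¹ hs rfl]
      -- the representative of the coset of `g t⁻¹` is `g t⁻¹ c`
      have hs' : (g * t⁻¹ * c)⁻¹ ∈ T₀.1 := by
        rw [mul_inv_rev, mul_inv_rev, inv_inv, inv_eq_self' c hc2, ← mul_assoc]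
        have h2 := (T₀.2 (c * (t * g⁻¹))).mpr
        rw [cmul_cmul c hc2] at h2
        rw [mul_assoc]
        exact h2 htg
      have hq : (QuotientGroup.mk (g * t⁻¹ * c) : G ⧸ Subgroup.zpowers c) =
          g • (QuotientGroup.mk t⁻¹ : G ⧸ Subgroup.zpowers c) := by
        rw [MulAction.Quotient.smul_mk, smul_eq_mul, eq_comm, QuotientGroup.eq]
        have e : (g * t⁻¹)⁻¹ * (g * t⁻¹ * c) = c := by group
        rw [e]
        exact Subgroup.mem_zpowers c
      rw [leftQuotientEquiv_eq c hc2 hc1 T₀ _ (g * t⁻¹ * c) hs' hq]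
      have e2 : (g * t⁻¹ * c)⁻¹ * (g * t⁻¹) = c⁻¹ := by group
      rw [e2, inv_eq_self' c hc2]
    · rw [inv_smul_smul, leftQuotientEquiv_eq c hc2 hc1 T₀ _ t⁻¹ hs rfl, inv_inv]

end Transfer

/-! ## §3 `δ = 1` iff the exponent of `G` divides `|G|/2` -/

section Delta

/-- **`wpar T₀ (T₀·Q⁻¹) = 0 ↔ Qⁿ = 1`** (`n = |G|/2`, `c` central). [folklore] -/
theorem wpar_rt_self_eq_zero_iff (hc2 : c * c = 1) (hc1 : c ≠ 1) (hcen : ∀ x : G, x * c = c * x) (T₀ : CMF G c)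
    (Q : G) : wpar c T₀ (rt c Q T₀) = 0 ↔ Q ^ (Fintype.card G / 2) = 1 := by
  have h := pow_half_card_eq c hc2 hc1 hcen T₀ Q⁻¹
  rw [inv_inv, inv_pow] at h
  have e1 : Q ^ (Fintype.card G / 2) = 1 ↔ c ^ (T₀.1 \ (rt c Q T₀).1).card = 1 := by rw [← h, inv_eq_one]
  have e2 : c ^ (T₀.1 \ (rt c Q T₀).1).card = 1 ↔ 2 ∣ (T₀.1 \ (rt c Q T₀).1).card := by
    rw [← orderOf_eq_two c hc2 hc1]; exact (orderOf_dvd_iff_pow_eq_one).symm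
  rw [e1, e2, wpar, ZMod.natCast_eq_zero_iff_even, even_iff_two_dvd]

/-- **The weight parity is constant on blocks iff `gⁿ = 1` for every `g ∈ G`** (`n = |G|/2`; `c` a central involution
`≠ 1`) — the transfer to `⟨c⟩` is `g ↦ gⁿ`. [folklore] -/
theorem invariant_iff_forall_pow_eq_one (hc2 : c * c = 1) (hc1 : c ≠ 1) (hcen : ∀ x : G, x * c = c * x)
    (T₀ : CMF G c) :
    (∀ (Q : G) (Ψ : CMF G c), wpar c T₀ (rt c Q Ψ) = wpar c T₀ Ψ) ↔ ∀ g : G, g ^ (Fintype.card G / 2) = 1 := by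
  rw [invariant_iff_self c hc2 T₀]
  exact forall_congr' fun Q => wpar_rt_self_eq_zero_iff c hc2 hc1 hcen T₀ Q

/-- **`δ(G, c) = 1 ⟺ ∀ g, g^{|G|/2} = 1`.** [folklore] -/
theorem wdelta_eq_one_iff (hc2 : c * c = 1) (hc1 : c ≠ 1) (hcen : ∀ x : G, x * c = c * x) (T₀ : CMF G c) :
    wdelta c T₀ = 1 ↔ ∀ g : G, g ^ (Fintype.card G / 2) = 1 := by
  rw [← invariant_iff_forall_pow_eq_one c hc2 hc1 hcen T₀]
  constructor
  · intro h
    by_contra hW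
    rw [wdelta_eq_zero c hW] at h
    exact absurd h (by decide)
  · exact wdelta_eq_one c

/-- **`δ = 0` as soon as one element has `g^{|G|/2} ≠ 1`.** [folklore] -/
theorem wdelta_eq_zero_of_pow_ne_one (hc2 : c * c = 1) (hc1 : c ≠ 1) (hcen : ∀ x : G, x * c = c * x)
    (T₀ : CMF G c) {g : G} (hg : g ^ (Fintype.card G / 2) ≠ 1) : wdelta c T₀ = 0 :=
  wdelta_eq_zero c fun h => hg ((invariant_iff_forall_pow_eq_one c hc2 hc1 hcen T₀).mp h g)

/-- **`δ = 0` when some element order does not divide `|G|/2`.** [folklore] -/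
theorem wdelta_eq_zero_of_not_orderOf_dvd (hc2 : c * c = 1) (hc1 : c ≠ 1) (hcen : ∀ x : G, x * c = c * x)
    (T₀ : CMF G c) {g : G} (hg : ¬ orderOf g ∣ Fintype.card G / 2) : wdelta c T₀ = 0 :=
  wdelta_eq_zero_of_pow_ne_one c hc2 hc1 hcen T₀ fun h => hg (orderOf_dvd_of_pow_eq_one h)

/-- **CYCLIC groups have `δ = 0`**: a generator has order `|G| ∤ |G|/2`.  So the block-parity law for every cyclic Galois CM
type reads `|S| ≥ β − 1`. [folklore] -/
theorem wdelta_eq_zero_of_isCyclic [IsCyclic G] (hc2 : c * c = 1) (hc1 : c ≠ 1) (hcen : ∀ x : G, x * c = c * x)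
    (T₀ : CMF G c) : wdelta c T₀ = 0 := by
  obtain ⟨g, hg⟩ := IsCyclic.exists_generator (α := G)
  have ho : orderOf g = Fintype.card G := by
    rw [← Nat.card_eq_fintype_card]; exact orderOf_eq_card_of_forall_mem_zpowers hg
  have h2 : 1 < Fintype.card G := Fintype.one_lt_card_iff_nontrivial.mpr ⟨⟨c, 1, hc1⟩⟩
  refine wdelta_eq_zero_of_not_orderOf_dvd c hc2 hc1 hcen T₀ (g := g) fun hdvd => ?_
  rw [ho] at hdvd
  have h3 := Nat.le_of_dvd (by omega) hdvd
  omega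

end Delta


end

end Summit.HodgeConjecture.CorCM.Census.BlockParity
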